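import Summits.Parity.GeneralizedHardyLittlewood.Theorems.LeeYangFibresRelativeDimOneMoebiusSplitDefs
import Summits.Parity.GeneralizedHardyLittlewood.Theorems.LeeYangFibresRelativeDimOneMoebiusSplitMoebiusTermBVAux1
import Summits.Parity.GeneralizedHardyLittlewood.Theorems.LeeYangFibresRelativeDimOneMoebiusSplitMoebiusTermBVAux3
import Literature.NumberTheory.Sieve.ParityWave0BombieriVinogradovProofs
import HarnessLib

/-!
# Route `LeeYangFibres`, crux `RelativeDimOne` (stmt-Parity-14113), line `single-moebius-split`:
# helper file 4 for the stub `stub_moebiusTermBV` — `Λ − Λ_R` summed over a residue class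

`classEstimate`: for a class `a (mod Q)` in a segment `(V₁, V₂] ⊆ (0, X]` and a truncation level
`R ≥ Rmin · Q`, `Rmin ≥ max(1, Q)`,
`|∑_{V₁ < v ≤ V₂, v ≡ a (Q)} (Λ(v) − Λ_R(v))| ≤ 2 G + Q (log₂ X + 1) log X + ((V₂−V₁)/Q) τ(Q) C e^{−c√log Rmin} + R (log R + 1)`,
where `G` is any common bound for the prime discrepancies `|ψ(w; Q, u) − w/φ(Q)|`, `1 ≤ w ≤ X`,
`u` a unit (supplied by Bombieri–Vinogradov, helper file 2).  Mechanism: the primes give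
`[a unit] (V₂ − V₁)/φ(Q) ± 2G` (non-reduced classes contain only powers of the primes dividing `Q`);
the truncated divisor sum gives `∑_{d ≤ R} μ(d) log(R/d) #{v : d ∣ v}` with
`#{v : d ∣ v} = [gcd(Q,d) ∣ a] (V₂−V₁) gcd(Q,d)/(Qd) + O(1)` (helper file 1), whose main term is
`((V₂−V₁)/Q) ([a unit] Q/φ(Q) + O(τ(Q) e^{−c√log Rmin}))` (helper file 3, Goldston–Yıldırım): the two
main terms cancel exactly, reduced class or not.

References: D. A. Goldston, C. Y. Yıldırım, Integers 3 (2003) A5, Lemma 2.1 and §"mixed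
correlations" [GoldstonYildirim2001]; H. Iwaniec, E. Kowalski, *Analytic Number Theory* (2004),
Thm. 17.1 [IwaniecKowalski2004].
-/

noncomputable section

open Finset
open scoped ArithmeticFunction.Moebius ArithmeticFunction.vonMangoldt

namespace Summit.Parity.GeneralizedHardyLittlewood.Cruxes.RelativeDimOne.SingleMoebiusSplit

open Literature.NumberTheory.Sieve.ParityWave0 (chebyshevPsiMod)

/-! ### The truncated divisor sum over a set of positive integers -/

/-- `Λ_R(v) = ∑_{d ≤ R, d ∣ v} μ(d) log(R/d)` for a positive integer `v`. [folklore] -/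
theorem lambdaR_natCast_eq {R : ℝ} (hR : 0 ≤ R) {v : ℕ} (hv : v ≠ 0) :
    lambdaR R (v : ℤ) = ∑ d ∈ (Icc 1 ⌊R⌋₊).filter (fun d => d ∣ v), (μ d : ℝ) * Real.log (R / d) := by
  unfold lambdaR
  rw [Int.toNat_natCast]
  refine Finset.sum_congr ?_ fun d _ => rfl
  ext d
  simp only [Finset.mem_filter, Nat.mem_divisors, Finset.mem_Icc]
  constructor
  · rintro ⟨⟨hdv, -⟩, hdR⟩
    exact ⟨⟨Nat.pos_of_dvd_of_pos hdv (Nat.pos_of_ne_zero hv), Nat.le_floor hdR⟩, hdv⟩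
  · rintro ⟨⟨-, hdR⟩, hdv⟩
    exact ⟨⟨hdv, hv⟩, le_trans (by exact_mod_cast hdR) (Nat.floor_le hR)⟩

/-- `∑_{v ∈ V} Λ_R(v) = ∑_{d ≤ R} μ(d) log(R/d) · #{v ∈ V : d ∣ v}` for a finite set `V` of positive
integers. [folklore] -/
theorem sum_lambdaR_eq {R : ℝ} (hR : 0 ≤ R) (V : Finset ℕ) (hV : ∀ v ∈ V, v ≠ 0) :
    ∑ v ∈ V, lambdaR R (v : ℤ) =
      ∑ d ∈ Icc 1 ⌊R⌋₊, (μ d : ℝ) * Real.log (R / d) * #(V.filter (fun v => d ∣ v)) := by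
  calc ∑ v ∈ V, lambdaR R (v : ℤ)
      = ∑ v ∈ V, ∑ d ∈ Icc 1 ⌊R⌋₊, (if d ∣ v then (μ d : ℝ) * Real.log (R / d) else 0) := by
        refine Finset.sum_congr rfl fun v hv => ?_
        rw [lambdaR_natCast_eq hR (hV v hv), Finset.sum_filter]
    _ = ∑ d ∈ Icc 1 ⌊R⌋₊, ∑ v ∈ V, (if d ∣ v then (μ d : ℝ) * Real.log (R / d) else 0) :=
        Finset.sum_comm
    _ = _ := by
        refine Finset.sum_congr rfl fun d _ => ?_
        rw [← Finset.sum_filter, Finset.sum_const, nsmul_eq_mul, mul_comm]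

/-! ### Primes in a class: the Chebyshev function and non-reduced classes -/

/-- `ψ(w; Q, a) = ∑_{n ≤ w, n ≡ a (Q)} Λ(n)` for a natural residue `a`. [folklore] -/
theorem chebyshevPsiMod_natCast_eq (Q a w : ℕ) :
    chebyshevPsiMod Q (a : ZMod Q) w = ∑ n ∈ (range (w + 1)).filter (fun n => n ≡ a [MOD Q]), Λ n := by
  classical
  unfold chebyshevPsiMod
  rw [Nat.floor_natCast, Finset.sum_filter]
  refine Finset.sum_congr rfl fun n _ => ?_
  unfold ArithmeticFunction.vonMangoldt.residueClass
  rw [Set.indicator_apply]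
  simp only [Set.mem_setOf_eq, ZMod.natCast_eq_natCast_iff]

/-- The von Mangoldt sum over a class in `(V₁, V₂]` is `ψ(V₂; Q, a) − ψ(V₁; Q, a)`. [folklore] -/
theorem sum_Ioc_filter_vonMangoldt_eq (Q a : ℕ) {V₁ V₂ : ℕ} (hV : V₁ ≤ V₂) :
    ∑ v ∈ (Ioc V₁ V₂).filter (fun v => v ≡ a [MOD Q]), Λ v =
      chebyshevPsiMod Q (a : ZMod Q) V₂ - chebyshevPsiMod Q (a : ZMod Q) V₁ := by
  rw [chebyshevPsiMod_natCast_eq, chebyshevPsiMod_natCast_eq, Finset.sum_filter, Finset.sum_filter,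
    Finset.sum_filter, Finset.range_eq_Ico, Finset.range_eq_Ico,
    ← Finset.sum_Ico_consecutive _ (Nat.zero_le (V₁ + 1)) (by omega : V₁ + 1 ≤ V₂ + 1)]
  have h : Finset.Ico (V₁ + 1) (V₂ + 1) = Finset.Ioc V₁ V₂ := by
    ext n; simp only [Finset.mem_Ico, Finset.mem_Ioc]; omega
  rw [h]
  ring

/-- **Non-reduced classes contain few prime powers**: if `gcd(a, Q) > 1` then
`∑_{V₁ < v ≤ V₂, v ≡ a (Q)} Λ(v) ≤ Q (log₂ X + 1) log X` for `V₂ ≤ X` (every such `v` with `Λ(v) ≠ 0`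
is `p^j` with `p ∣ Q`, `j ≤ log₂ X`). [folklore] -/
theorem sum_vonMangoldt_nonunit_le {Q a : ℕ} (hQ : 0 < Q) (ha : ¬ Nat.Coprime a Q) {V₁ V₂ X : ℕ}
    (hVX : V₂ ≤ X) :
    ∑ v ∈ (Ioc V₁ V₂).filter (fun v => v ≡ a [MOD Q]), Λ v ≤ Q * (Nat.log 2 X + 1) * Real.log X := by
  classical
  set V := (Ioc V₁ V₂).filter (fun v => v ≡ a [MOD Q]) with hVdef
  have hlogX : 0 ≤ Real.log X := Real.log_natCast_nonneg X
  -- the support of `Λ` on the class consists of powers of the primes dividing `Q`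
  have hsub : V.filter (fun v => Λ v ≠ 0) ⊆
      (Q.primeFactors ×ˢ Icc 1 (Nat.log 2 X)).image (fun pj => pj.1 ^ pj.2) := by
    intro v hv
    rw [Finset.mem_filter, hVdef, Finset.mem_filter, Finset.mem_Ioc] at hv
    obtain ⟨⟨⟨hv1, hv2⟩, hva⟩, hΛ⟩ := hv
    obtain ⟨p, j, hp, hj, hpj⟩ := (isPrimePow_nat_iff v).1
      (ArithmeticFunction.vonMangoldt_ne_zero_iff.1 hΛ)
    have hvQ : ¬ Nat.Coprime v Q := fun h => ha (by
      have e : Nat.gcd a Q = Nat.gcd v Q := (Nat.ModEq.gcd_eq hva).symm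
      exact Nat.coprime_iff_gcd_eq_one.2 (e.trans (Nat.coprime_iff_gcd_eq_one.1 h)))
    obtain ⟨p', hp', hp'v, hp'Q⟩ := Nat.Prime.not_coprime_iff_dvd.1 hvQ
    have hpp' : p' = p := by
      rw [← hpj] at hp'v
      exact (Nat.prime_dvd_prime_iff_eq hp' hp).1 (hp'.dvd_of_dvd_pow hp'v)
    rw [Finset.mem_image]
    refine ⟨(p, j), Finset.mem_product.2 ⟨Nat.mem_primeFactors.2 ⟨hp, hpp' ▸ hp'Q, hQ.ne'⟩, ?_⟩, hpj⟩
    rw [Finset.mem_Icc]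
    refine ⟨hj, Nat.le_log_of_pow_le (by norm_num) ?_⟩
    calc 2 ^ j ≤ p ^ j := Nat.pow_le_pow_left hp.two_le j
      _ = v := hpj
      _ ≤ X := hv2.trans hVX
  have hcard : (#(V.filter (fun v => Λ v ≠ 0)) : ℝ) ≤ Q * (Nat.log 2 X + 1) := by
    have h1 := (Finset.card_le_card hsub).trans Finset.card_image_le
    rw [Finset.card_product, Nat.card_Icc, Nat.add_sub_cancel] at h1
    have hω : #Q.primeFactors ≤ Q := by
      refine (Finset.card_le_card fun p hp => ?_).trans (Nat.card_divisors_le_self Q)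
      have hp' := Nat.mem_primeFactors.1 hp
      exact Nat.mem_divisors.2 ⟨hp'.2.1, hp'.2.2⟩
    have h2 : #(V.filter (fun v => Λ v ≠ 0)) ≤ Q * (Nat.log 2 X + 1) :=
      h1.trans ((Nat.mul_le_mul hω (Nat.le_succ _)))
    exact_mod_cast h2
  calc ∑ v ∈ V, Λ v = ∑ v ∈ V.filter (fun v => Λ v ≠ 0), Λ v := (Finset.sum_filter_ne_zero V).symm
    _ ≤ ∑ _v ∈ V.filter (fun v => Λ v ≠ 0), Real.log X := by
        refine Finset.sum_le_sum fun v hv => ?_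
        rw [Finset.mem_filter, hVdef, Finset.mem_filter, Finset.mem_Ioc] at hv
        have hv1 : (1 : ℝ) ≤ v := by
          have := hv.1.1.1
          exact_mod_cast (by omega : 1 ≤ v)
        have hvX : (v : ℝ) ≤ X := by exact_mod_cast hv.1.1.2.trans hVX
        exact ArithmeticFunction.vonMangoldt_le_log.trans (Real.log_le_log (by linarith) hvX)
    _ = #(V.filter (fun v => Λ v ≠ 0)) * Real.log X := by rw [Finset.sum_const, nsmul_eq_mul]
    _ ≤ Q * (Nat.log 2 X + 1) * Real.log X := mul_le_mul_of_nonneg_right hcard hlogX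

/-! ### The estimate -/

/-- **`Λ − Λ_R` over a residue class.** There are `c > 0`, `C ≥ 0` such that for `Q ≥ 1`, a class
`a (mod Q)`, a segment `(V₁, V₂] ⊆ (0, X]` (`X ≥ 2`), a level `R ≥ Rmin · Q` with `Rmin ≥ max(1, Q)`,
and any common bound `G` of the prime discrepancies `|ψ(w; Q, u) − w/φ(Q)|` (`1 ≤ w ≤ X`, `u` a unit):
`|∑_{V₁ < v ≤ V₂, v ≡ a (Q)} (Λ(v) − Λ_R(v))| ≤ 2G + Q(log₂ X + 1) log X + ((V₂−V₁)/Q) τ(Q) C e^{−c√log Rmin} + R(log R + 1)`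
— the main terms `[a reduced] (V₂−V₁)/φ(Q)` of the primes (Bombieri–Vinogradov input `G`) and of
the truncated divisor sum (Goldston–Yıldırım, `classMainTerm`) cancel. [cite: GoldstonYildirim2001, Lemma 2.1] -/
theorem classEstimate : ∃ c C : ℝ, 0 < c ∧ 0 ≤ C ∧ ∀ (Q : ℕ), 0 < Q → ∀ (a V₁ V₂ X : ℕ), V₁ ≤ V₂ → V₂ ≤ X → 2 ≤ X → ∀ (R Rmin : ℝ), 1 ≤ Rmin → Rmin * Q ≤ R → (Q : ℝ) ≤ Rmin → ∀ Gq : ℝ, (∀ w : ℕ, 1 ≤ w → w ≤ X → ∀ u : (ZMod Q)ˣ, |chebyshevPsiMod Q (u : ZMod Q) w - w / Nat.totient Q| ≤ Gq) → |∑ v ∈ (Finset.Ioc V₁ V₂).filter (fun v : ℕ => v ≡ a [MOD Q]), (ArithmeticFunction.vonMangoldt v - lambdaR R v)| ≤ 2 * Gq + Q * (Nat.log 2 X + 1) * Real.log X + ((V₂ : ℝ) - V₁) / Q * Q.divisors.card * (C * Real.exp (-c * Real.sqrt (Real.log Rmin))) + R * (Real.log R + 1) := by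
  classical
  obtain ⟨c, C, hc, hC0, hM⟩ := classMainTerm
  refine ⟨c, C, hc, hC0, ?_⟩
  intro Q hQ a V₁ V₂ X hV hVX hX R Rmin hRmin hRQ hQR Gq hG
  haveI : NeZero Q := ⟨hQ.ne'⟩
  set V := (Ioc V₁ V₂).filter (fun v : ℕ => v ≡ a [MOD Q]) with hVdef
  set E : ℝ := C * Real.exp (-c * Real.sqrt (Real.log Rmin)) with hE
  have hE0 : 0 ≤ E := mul_nonneg hC0 (Real.exp_pos _).le
  have hQ1 : (1 : ℝ) ≤ Q := by exact_mod_cast hQ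
  have hQ0 : (0 : ℝ) < Q := by linarith
  have hR1 : 1 ≤ R := le_trans (by nlinarith) hRQ
  have hR0 : 0 ≤ R := by linarith
  have hX1 : 1 ≤ X := by omega
  have hW0 : 0 ≤ (V₂ : ℝ) - V₁ := by
    have : (V₁ : ℝ) ≤ V₂ := by exact_mod_cast hV
    linarith
  have hGq0 : 0 ≤ Gq := le_trans (abs_nonneg _) (hG X hX1 le_rfl 1)
  have hlogX : 0 ≤ Real.log X := Real.log_natCast_nonneg X
  have hJ0 : 0 ≤ (Q : ℝ) * (Nat.log 2 X + 1) * Real.log X := by positivity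
  have hφ0 : (0 : ℝ) < Nat.totient Q := by exact_mod_cast Nat.totient_pos.2 hQ
  -- the truncated divisor sum: swap, count, main term
  set G₀ : ℕ := Nat.gcd a Q with hG₀
  have hG₀Q : G₀ ∣ Q := Nat.gcd_dvd_right _ _
  have hG₀le : (G₀ : ℝ) ≤ Q := by exact_mod_cast Nat.le_of_dvd hQ hG₀Q
  have hτ : (G₀.divisors.card : ℝ) ≤ Q.divisors.card := by
    exact_mod_cast Finset.card_le_card (Nat.divisors_subset_of_dvd hQ.ne' hG₀Q)
  set 𝔐 : ℝ := ∑ d ∈ Icc 1 ⌊R⌋₊, (μ d : ℝ) * Real.log (R / d) *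
    (if Nat.gcd Q d ∣ G₀ then (Nat.gcd Q d : ℝ) / d else 0) with h𝔐def
  have h𝔐b := hM Q hQ G₀ hG₀Q R Rmin hRmin (le_trans (by nlinarith) hRQ) hQR
  have h𝔐' : |𝔐 - (if G₀ = 1 then (Q : ℝ) / Nat.totient Q else 0)| ≤ Q.divisors.card * E := by
    refine h𝔐b.trans ?_
    rw [hE]
    have : 0 ≤ C * Real.exp (-c * Real.sqrt (Real.log Rmin)) := hE0
    nlinarith
  -- the count of multiples of `d` in the class
  have hcnt : ∀ d ∈ Icc 1 ⌊R⌋₊, |(#(V.filter (fun v => d ∣ v)) : ℝ) -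
      ((V₂ : ℝ) - V₁) / Q * (if Nat.gcd Q d ∣ G₀ then (Nat.gcd Q d : ℝ) / d else 0)| ≤ 1 := by
    intro d hd
    have hd0 : 0 < d := (Finset.mem_Icc.1 hd).1
    have h := abs_card_filter_modEq_dvd_sub_le Q d hQ hd0 (a : ℤ) V₁ V₂ hV
    have hfilt : V.filter (fun v => d ∣ v) =
        (Ioc V₁ V₂).filter (fun v : ℕ => (v : ℤ) ≡ (a : ℤ) [ZMOD Q] ∧ d ∣ v) := by
      rw [hVdef, Finset.filter_filter]
      refine Finset.filter_congr fun v _ => ?_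
      rw [Int.natCast_modEq_iff]
    have hiff : (((Nat.gcd Q d : ℕ) : ℤ) ∣ (a : ℤ)) ↔ Nat.gcd Q d ∣ G₀ := by
      rw [Int.natCast_dvd_natCast, hG₀, Nat.dvd_gcd_iff]
      exact ⟨fun h1 => ⟨h1, Nat.gcd_dvd_left _ _⟩, fun h1 => h1.1⟩
    rw [hfilt]
    have hmain : ((V₂ : ℝ) - V₁) / Q * (if Nat.gcd Q d ∣ G₀ then (Nat.gcd Q d : ℝ) / d else 0) =
        (if ((Nat.gcd Q d : ℕ) : ℤ) ∣ (a : ℤ) then ((V₂ : ℝ) - V₁) * (Nat.gcd Q d) / ((Q : ℝ) * d)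
          else 0) := by
      by_cases h1 : Nat.gcd Q d ∣ G₀
      · rw [if_pos h1, if_pos (hiff.2 h1)]
        have hd0' : (0 : ℝ) < d := by exact_mod_cast hd0
        field_simp
      · rw [if_neg h1, if_neg (fun h2 => h1 (hiff.1 h2)), mul_zero]
    rw [hmain]
    exact h
  have hSR : |∑ v ∈ V, lambdaR R (v : ℤ) - ((V₂ : ℝ) - V₁) / Q * 𝔐| ≤ R * Real.log R := by
    have hVpos : ∀ v ∈ V, v ≠ 0 := by
      intro v hv
      rw [hVdef, Finset.mem_filter, Finset.mem_Ioc] at hv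
      omega
    rw [sum_lambdaR_eq hR0 V hVpos, h𝔐def, Finset.mul_sum, ← Finset.sum_sub_distrib]
    have hterm : ∀ d ∈ Icc 1 ⌊R⌋₊,
        |(μ d : ℝ) * Real.log (R / d) * #(V.filter (fun v => d ∣ v)) -
          ((V₂ : ℝ) - V₁) / Q * ((μ d : ℝ) * Real.log (R / d) *
            (if Nat.gcd Q d ∣ G₀ then (Nat.gcd Q d : ℝ) / d else 0))| ≤ Real.log R := by
      intro d hd
      have hd1 : (1 : ℝ) ≤ d := by exact_mod_cast (Finset.mem_Icc.1 hd).1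
      have hdR : (d : ℝ) ≤ R := le_trans (by exact_mod_cast (Finset.mem_Icc.1 hd).2) (Nat.floor_le hR0)
      have hlog0 : 0 ≤ Real.log (R / d) := Real.log_nonneg ((one_le_div (by linarith)).2 hdR)
      have hlogR : Real.log (R / d) ≤ Real.log R := by
        refine Real.log_le_log (by positivity) ?_
        exact div_le_self hR0 hd1
      have hμ : |(μ d : ℝ)| ≤ 1 := by exact_mod_cast ArithmeticFunction.abs_moebius_le_one
      rw [show (μ d : ℝ) * Real.log (R / d) * #(V.filter (fun v => d ∣ v)) -
          ((V₂ : ℝ) - V₁) / Q * ((μ d : ℝ) * Real.log (R / d) *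
            (if Nat.gcd Q d ∣ G₀ then (Nat.gcd Q d : ℝ) / d else 0)) =
          ((μ d : ℝ) * Real.log (R / d)) * ((#(V.filter (fun v => d ∣ v)) : ℝ) -
            ((V₂ : ℝ) - V₁) / Q * (if Nat.gcd Q d ∣ G₀ then (Nat.gcd Q d : ℝ) / d else 0)) by ring,
        abs_mul, abs_mul, abs_of_nonneg hlog0]
      calc |(μ d : ℝ)| * Real.log (R / d) * |((#(V.filter (fun v => d ∣ v)) : ℝ) -
            ((V₂ : ℝ) - V₁) / Q * (if Nat.gcd Q d ∣ G₀ then (Nat.gcd Q d : ℝ) / d else 0))|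
          ≤ 1 * Real.log R * 1 := by
            refine mul_le_mul (mul_le_mul hμ hlogR hlog0 zero_le_one) (hcnt d hd) (abs_nonneg _) ?_
            rw [one_mul]; exact Real.log_nonneg hR1
        _ = Real.log R := by ring
    calc |∑ d ∈ Icc 1 ⌊R⌋₊, ((μ d : ℝ) * Real.log (R / d) * #(V.filter (fun v => d ∣ v)) -
          ((V₂ : ℝ) - V₁) / Q * ((μ d : ℝ) * Real.log (R / d) *
            (if Nat.gcd Q d ∣ G₀ then (Nat.gcd Q d : ℝ) / d else 0)))|
        ≤ ∑ d ∈ Icc 1 ⌊R⌋₊, |(μ d : ℝ) * Real.log (R / d) * #(V.filter (fun v => d ∣ v)) -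
          ((V₂ : ℝ) - V₁) / Q * ((μ d : ℝ) * Real.log (R / d) *
            (if Nat.gcd Q d ∣ G₀ then (Nat.gcd Q d : ℝ) / d else 0))| := Finset.abs_sum_le_sum_abs _ _
      _ ≤ ∑ _d ∈ Icc 1 ⌊R⌋₊, Real.log R := Finset.sum_le_sum hterm
      _ = ⌊R⌋₊ * Real.log R := by rw [Finset.sum_const, Nat.card_Icc, nsmul_eq_mul]; norm_num
      _ ≤ R * Real.log R := mul_le_mul_of_nonneg_right (Nat.floor_le hR0) (Real.log_nonneg hR1)
  -- the primes
  have hSL : ∑ v ∈ V, Λ v = chebyshevPsiMod Q (a : ZMod Q) V₂ - chebyshevPsiMod Q (a : ZMod Q) V₁ :=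
    sum_Ioc_filter_vonMangoldt_eq Q a hV
  have hψ0 : chebyshevPsiMod Q (a : ZMod Q) (0 : ℕ) = 0 := by
    rw [chebyshevPsiMod_natCast_eq, Finset.sum_filter]
    simp
  -- discrepancy bound at an integer cut-off `w ≤ X` (including `w = 0`) in a reduced class
  have hdisc : ∀ u : (ZMod Q)ˣ, (u : ZMod Q) = (a : ZMod Q) → ∀ w : ℕ, w ≤ X →
      |chebyshevPsiMod Q (a : ZMod Q) w - w / Nat.totient Q| ≤ Gq := by
    intro u hu w hw
    rcases Nat.eq_zero_or_pos w with h0 | hpos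
    · subst h0
      rw [hψ0]; simp [hGq0]
    · rw [← hu]; exact hG w hpos hw u
  rw [Finset.sum_sub_distrib]
  by_cases hunit : Nat.Coprime a Q
  · -- reduced class: both main terms are `(V₂ − V₁)/φ(Q)`
    have hG₀1 : G₀ = 1 := Nat.coprime_iff_gcd_eq_one.1 hunit
    rw [if_pos hG₀1] at h𝔐'
    set u := ZMod.unitOfCoprime a hunit with hu
    have hu' : (u : ZMod Q) = (a : ZMod Q) := ZMod.coe_unitOfCoprime a hunit
    have h2 := hdisc u hu' V₂ hVX
    have h1 := hdisc u hu' V₁ (hV.trans hVX)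
    have hkey : ∑ v ∈ V, Λ v - ∑ v ∈ V, lambdaR R (v : ℤ) =
        (chebyshevPsiMod Q (a : ZMod Q) V₂ - V₂ / Nat.totient Q) -
        (chebyshevPsiMod Q (a : ZMod Q) V₁ - V₁ / Nat.totient Q) -
        ((V₂ : ℝ) - V₁) / Q * (𝔐 - (Q : ℝ) / Nat.totient Q) -
        (∑ v ∈ V, lambdaR R (v : ℤ) - ((V₂ : ℝ) - V₁) / Q * 𝔐) := by
      rw [hSL]; field_simp; ring
    rw [hkey]
    have h3 : |((V₂ : ℝ) - V₁) / Q * (𝔐 - (Q : ℝ) / Nat.totient Q)| ≤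
        ((V₂ : ℝ) - V₁) / Q * Q.divisors.card * E := by
      rw [abs_mul, abs_of_nonneg (div_nonneg hW0 hQ0.le), mul_assoc]
      exact mul_le_mul_of_nonneg_left h𝔐' (div_nonneg hW0 hQ0.le)
    calc |(chebyshevPsiMod Q (a : ZMod Q) V₂ - V₂ / Nat.totient Q) -
          (chebyshevPsiMod Q (a : ZMod Q) V₁ - V₁ / Nat.totient Q) -
          ((V₂ : ℝ) - V₁) / Q * (𝔐 - (Q : ℝ) / Nat.totient Q) -
          (∑ v ∈ V, lambdaR R (v : ℤ) - ((V₂ : ℝ) - V₁) / Q * 𝔐)|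
        ≤ |chebyshevPsiMod Q (a : ZMod Q) V₂ - V₂ / Nat.totient Q| +
          |chebyshevPsiMod Q (a : ZMod Q) V₁ - V₁ / Nat.totient Q| +
          |((V₂ : ℝ) - V₁) / Q * (𝔐 - (Q : ℝ) / Nat.totient Q)| +
          |∑ v ∈ V, lambdaR R (v : ℤ) - ((V₂ : ℝ) - V₁) / Q * 𝔐| := by
          refine (abs_sub _ _).trans (add_le_add ((abs_sub _ _).trans (add_le_add
            ((abs_sub _ _).trans le_rfl) le_rfl)) le_rfl)
      _ ≤ Gq + Gq + ((V₂ : ℝ) - V₁) / Q * Q.divisors.card * E + R * Real.log R :=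
          add_le_add (add_le_add (add_le_add h2 h1) h3) hSR
      _ ≤ _ := by rw [hE]; nlinarith
  · -- non-reduced class: no main term on either side
    have hG₀1 : G₀ ≠ 1 := fun h => hunit (Nat.coprime_iff_gcd_eq_one.2 h)
    rw [if_neg hG₀1, sub_zero] at h𝔐'
    have hΛ := sum_vonMangoldt_nonunit_le hQ hunit (V₁ := V₁) hVX
    have hΛ0 : 0 ≤ ∑ v ∈ V, Λ v := Finset.sum_nonneg fun v _ => ArithmeticFunction.vonMangoldt_nonneg
    have hkey : ∑ v ∈ V, Λ v - ∑ v ∈ V, lambdaR R (v : ℤ) =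
        ∑ v ∈ V, Λ v - ((V₂ : ℝ) - V₁) / Q * 𝔐 -
        (∑ v ∈ V, lambdaR R (v : ℤ) - ((V₂ : ℝ) - V₁) / Q * 𝔐) := by ring
    rw [hkey]
    have h3 : |((V₂ : ℝ) - V₁) / Q * 𝔐| ≤ ((V₂ : ℝ) - V₁) / Q * Q.divisors.card * E := by
      rw [abs_mul, abs_of_nonneg (div_nonneg hW0 hQ0.le), mul_assoc]
      exact mul_le_mul_of_nonneg_left h𝔐' (div_nonneg hW0 hQ0.le)
    calc |∑ v ∈ V, Λ v - ((V₂ : ℝ) - V₁) / Q * 𝔐 -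
          (∑ v ∈ V, lambdaR R (v : ℤ) - ((V₂ : ℝ) - V₁) / Q * 𝔐)|
        ≤ |∑ v ∈ V, Λ v| + |((V₂ : ℝ) - V₁) / Q * 𝔐| +
          |∑ v ∈ V, lambdaR R (v : ℤ) - ((V₂ : ℝ) - V₁) / Q * 𝔐| :=
          (abs_sub _ _).trans (add_le_add (abs_sub _ _) le_rfl)
      _ ≤ Q * (Nat.log 2 X + 1) * Real.log X + ((V₂ : ℝ) - V₁) / Q * Q.divisors.card * E +
          R * Real.log R := by
          rw [abs_of_nonneg hΛ0]
          exact add_le_add (add_le_add hΛ h3) hSR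
      _ ≤ _ := by rw [hE]; nlinarith

end Summit.Parity.GeneralizedHardyLittlewood.Cruxes.RelativeDimOne.SingleMoebiusSplit
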